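import Summits.BirchSwinnertonDyer.BirchSwinnertonDyer.Theorems.EisensteinPrimesPoitouTateReciprocityS
import Literature.NumberTheory.GaloisCohomology.PoitouTateRestrictedShaNaturalAtOfP2monoLayerNat
import HarnessLib

/-!
# `poitouTate_shaRestricted_tateDual_natural_at K S` for `K` totally complex and `S` finite, MODULO [P2-mono] ALONE
# (Milne *ADT* I Thm. 4.10 (a) for `G_S`, the lane's END shape with every other input discharged by name)

Cell `bsd-eis` (run/shared/lean/pub/bsd-eis/), width seat `bsd-line-x1-p1-w2` gen 12 (KIT GLUE / ADAPTER #2); crux 2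
`GoodLatticeBDPValue` (stmt-BirchSwinnertonDyer-19032), line `halves`, background lane «PT-Ш-S-TC» (LEAD bsd-line-x1-p1 g11,
RULING #9 = the END name, RULING #10 = Summits-side module).  Theorems only (no definition, no named fact, no instance, no
notation, no `sorry`); `--supports stmt-BirchSwinnertonDyer-19032 --as helper`.  Summits-side because the `S`-reciprocity law
(R4)_S it consumes (`PoitouTateReciprocityS.read_idelePart_eq_sum`, bsd-eis -w5 g11) rests on door-c4/c5's all-places
reciprocity files under `Summits/…/Theorems/SchneiderFreeAdditiveX3PoitouTate*`.

* `natural_at_of_P2mono` — `Literature…ShaExtRoadKit.natural_at_of_P2mono_natLayerS` (the `Ext`-road kit with `Σ = Ω_∞ ⊔ S'`,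
  `linv := LocalInvariants.canonical`, Tate duality `α¹` (bsd-eis -w8 g13), `Ψ(E) = Ш²_S` (-w2 g12 FILE Ψ), `nat := natLayerS`
  (-w5 g11 / -w6 g12)) with the `S`-READOUT TRIPLE DISCHARGED: `R := HomDual.readoutSExtB` (-w5 F1b), (R3)
  `HomDual.exists_forall_mem_readoutSExtB_eq`, (R4) `PoitouTateReciprocityS.read_idelePart_eq_sum` (-w5 F2), the `G_S`-module
  hypothesis `N_S ≤ ker M^D(n)` by `PoitouTateReciprocityS.ramificationSubgroup_le_ker_tateDual`.  ONE displayed input: [P2-mono]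
  at `S'` (Milne I Lemma 4.13 at `r = 2` in -w4 g20's E4e binder, every open normal `U ≤ G_S`).
* `forall_natural_at_of_P2mono` — the END shape `∀ K [IsTotallyComplex K] (S : Set _), S.Finite → …` from [P2-mono] at every
  `(K, S')` (`Set.Finite.exists_finset_coe`).

HONEST FRAMING: plumbing; [P2-mono] is NOT proved here (it is LEAD g11's `IdeleReadout.p2mono` on -w8 g13's finite-level export);
no summit statement, no crux, no stub and no case of BSD is proved here, and the new content towards Poitou–Tate duality is the
lane's, not this file's.  AI formalisation, established only by the kernel check.

## References
* J. S. Milne, *Arithmetic Duality Theorems*, 2nd ed. (2006), I Thm. 4.10 (a) (p. 57), its proof (p. 58), Lemma 4.13, §4 p. 65.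
  [MilneADT2006]
* D. Harari, *Galois Cohomology and Class Field Theory*, Universitext (2020), §17.4 (17.1), Thm. 17.13 (b), Prop. 17.25–17.26, §17.5.
  [Harari2020]
-/

noncomputable section

open scoped NumberField ContRepresentation
open Function CategoryTheory CategoryTheory.Abelian NumberField IsDedekindDomain Field
open Literature.Algebra.Homology Literature.Algebra.Homology.DiscreteRep
open Literature.NumberTheory.GaloisRepresentations
open Literature.NumberTheory.GaloisRepresentations.DiscreteGaloisModule
open Literature.NumberTheory.GaloisCohomology

set_option linter.dupNamespace false
set_option autoImplicit false

namespace Summit.BirchSwinnertonDyer.BirchSwinnertonDyer.Theorems.PoitouTateShaNaturalAtOfP2mono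

set_option maxRecDepth 16384 in
-- (as in the lane's kit files: the composed `Ext`/`Hʳ` objects exceed the default recursion depth)
/-- **`poitouTate_shaRestricted_tateDual_natural_at K ↑S'` for `K` totally complex, modulo [P2-mono] at `S'` alone.**
[cite: MilneADT2006, I Thm. 4.10 (a) (p. 57), its proof (p. 58), Lemma 4.13][cite: Harari2020, Thm. 17.13 (b), Prop. 17.26, §17.5] -/
theorem natural_at_of_P2mono (K : Type) [Field K] [NumberField K] [IsTotallyComplex K]
    (S : Finset (HeightOneSpectrum (𝓞 K)))
    (hP2 : ∀ (U : Subgroup (GaloisGroupUnramifiedOutside K (↑S : Set (HeightOneSpectrum (𝓞 K))))) [U.Normal]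
      (_ : IsOpen (U : Set (GaloisGroupUnramifiedOutside K (↑S : Set (HeightOneSpectrum (𝓞 K)))))) [U.FiniteIndex],
      ∀ y : Ext (triv (k := ℤ) (Γ := ↥U) ℤ) ((resD ℤ U).obj (IdeleClassBar.truncIdeleBarD K S)) 2,
        (∀ (w : IdeleReadout.OverS K S) (t : DoubleCosets (IdeleReadout.decompMapPlaceS K S w.1) U),
          (y.mapExactFunctor (resDHom ℤ (conjHom (IdeleReadout.decompMapPlaceS K S w.1) U
              (dcRep (IdeleReadout.decompMapPlaceS K S w.1) U t))
            (continuous_conjHom (IdeleReadout.decompMapPlaceS K S w.1) (IdeleReadout.continuous_decompMapPlaceS K S w.1) U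
              (dcRep (IdeleReadout.decompMapPlaceS K S w.1) U t)))).comp
            (Ext.mk₀ (conjCoeff (IdeleReadout.decompMapPlaceS K S w.1) (IdeleReadout.continuous_decompMapPlaceS K S w.1) U
              (IdeleClassBar.truncIdeleBarD K S) (IdeleReadout.unitsD (Place.Completion w.1)) (IdeleReadout.locQ K S w)
              (dcRep (IdeleReadout.decompMapPlaceS K S w.1) U t) (k := ℤ))) (add_zero 2) = 0) → y = 0) :
    poitouTate_shaRestricted_tateDual_natural_at K (↑S : Set (HeightOneSpectrum (𝓞 K))) :=
  ShaExtRoadKit.natural_at_of_P2mono_natLayerS K S hP2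
    (fun n _ M _ _ _ _ ρ hn hur hS v =>
      haveI : Finite (TateDual K M n) := TateDual.finite K M n
      HomDual.readoutSExtB ρ n S (PoitouTateReciprocityS.ramificationSubgroup_le_ker_tateDual ρ n S hur hS) hn v)
    (fun n _ M _ _ _ _ ρ hn hur hS t =>
      haveI : Finite (TateDual K M n) := TateDual.finite K M n
      HomDual.exists_forall_mem_readoutSExtB_eq ρ n S (PoitouTateReciprocityS.ramificationSubgroup_le_ker_tateDual ρ n S hur hS)
        hn _ (ShaExtRoadKit.inr_mem_sigma_iff K S) t)
    (fun n _ M _ _ _ _ ρ hn hur hS e y =>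
      haveI : Finite (TateDual K M n) := TateDual.finite K M n
      PoitouTateReciprocityS.read_idelePart_eq_sum ρ n hn S
        (PoitouTateReciprocityS.ramificationSubgroup_le_ker_tateDual ρ n S hur hS) _ (ShaExtRoadKit.inl_mem_sigma K S)
        (ShaExtRoadKit.inr_mem_sigma_iff K S) e y)

set_option maxRecDepth 16384 in
/-- **The lane's END shape modulo [P2-mono]**: if [P2-mono] holds at every `(K, S')` with `K` totally complex, then
`poitouTate_shaRestricted_tateDual_natural_at K S` holds for every totally complex `K` and every finite `S`.
[cite: MilneADT2006, I Thm. 4.10 (a) (p. 57), Lemma 4.13][cite: Harari2020, Thm. 17.13 (b), §17.5] -/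
theorem forall_natural_at_of_P2mono
    (hP2 : ∀ (K : Type) [Field K] [NumberField K] [IsTotallyComplex K] (S : Finset (HeightOneSpectrum (𝓞 K)))
      (U : Subgroup (GaloisGroupUnramifiedOutside K (↑S : Set (HeightOneSpectrum (𝓞 K))))) [U.Normal]
      (_ : IsOpen (U : Set (GaloisGroupUnramifiedOutside K (↑S : Set (HeightOneSpectrum (𝓞 K)))))) [U.FiniteIndex],
      ∀ y : Ext (triv (k := ℤ) (Γ := ↥U) ℤ) ((resD ℤ U).obj (IdeleClassBar.truncIdeleBarD K S)) 2,
        (∀ (w : IdeleReadout.OverS K S) (t : DoubleCosets (IdeleReadout.decompMapPlaceS K S w.1) U),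
          (y.mapExactFunctor (resDHom ℤ (conjHom (IdeleReadout.decompMapPlaceS K S w.1) U
              (dcRep (IdeleReadout.decompMapPlaceS K S w.1) U t))
            (continuous_conjHom (IdeleReadout.decompMapPlaceS K S w.1) (IdeleReadout.continuous_decompMapPlaceS K S w.1) U
              (dcRep (IdeleReadout.decompMapPlaceS K S w.1) U t)))).comp
            (Ext.mk₀ (conjCoeff (IdeleReadout.decompMapPlaceS K S w.1) (IdeleReadout.continuous_decompMapPlaceS K S w.1) U
              (IdeleClassBar.truncIdeleBarD K S) (IdeleReadout.unitsD (Place.Completion w.1)) (IdeleReadout.locQ K S w)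
              (dcRep (IdeleReadout.decompMapPlaceS K S w.1) U t) (k := ℤ))) (add_zero 2) = 0) → y = 0) :
    ∀ (K : Type) [Field K] [NumberField K] [IsTotallyComplex K] (S : Set (HeightOneSpectrum (𝓞 K))), S.Finite →
      poitouTate_shaRestricted_tateDual_natural_at K S := by
  intro K _ _ _ S hS
  obtain ⟨S', rfl⟩ := hS.exists_finset_coe
  exact natural_at_of_P2mono K S' (fun U _ hU _ => hP2 K S' U hU)

end Summit.BirchSwinnertonDyer.BirchSwinnertonDyer.Theorems.PoitouTateShaNaturalAtOfP2mono

end
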